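import Literature.AlgebraicTopology.Homotopy.CellularRadialPush
import Literature.AlgebraicTopology.Homotopy.SequenceTelescopeCW
import Literature.AlgebraicTopology.Homotopy.MappingTelescopeHomotopy
import HarnessLib

/-!
# Pushing a cube into the skeleton: the induction step of cellular approximation

Topic `Literature/AlgebraicTopology/Homotopy`. The heart of the proof of the cellular
approximation theorem (Hatcher, *Algebraic Topology* (2002), Thm. 4.8, p. 349): a map of the
closed `n`-cube into a CW complex `Y` is homotopic, relative to the points already mapped into
the `n`-skeleton `Yⁿ = skeletonLT (n+1)`, to a map into `Yⁿ`. As in Hatcher's proof, the compact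
image meets only finitely many cells (`finite_cells_inter_of_isCompact`), and the cells of
dimension `> n` met are cleared one at a time, top dimension first: first the map is deformed
inside the cell to miss a point (`exists_homotopy_missing_point`, Hatcher's Lemma 4.10), then
pushed off the cell along the radial deformation of the punctured cell onto its frontier
(`exists_homotopy_off_cell`).

* `concatHtpy F G`: concatenation of two homotopies `X × ℝ → Z` (run `F` on `[0, ½]`, `G` on
  `[½, 1]`), with its continuity on `S × [0, 1]`.
* `exists_homotopy_clear_cell`, `exists_homotopy_clear_dim`: clearing one open `(m+1)`-cell,
  resp. all open `(m+1)`-cells, from a map of the `n`-cube (`n ≤ m`) into `skeletonLT (m+2)`.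
* `exists_homotopy_into_skeleton`: for `c : ℝⁿ ⊇ closedBall 0 1 → Y` continuous, a jointly
  continuous homotopy on `closedBall 0 1 × [0, 1]` from `c`, stationary at every `w` with
  `c w ∈ skeletonLT (n+1)`, to a map into `skeletonLT (n+1)`.

No named facts, no `sorry`.

## References

* A. Hatcher, *Algebraic Topology*, CUP (2002), §4.1, Thm. 4.8 and its proof, Lemma 4.10
  (pp. 349–351). [HatcherAT2002]
-/

noncomputable section

open Set Metric Function Topology Filter

namespace Literature.AlgebraicTopology.Homotopy

/-! ### Concatenation of homotopies on a set -/

section Concat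

variable {X Z : Type*}

/-- Concatenation of homotopies given as maps `X × ℝ → Z`: `F` at double speed on `t ≤ ½`,
then `G`. [folklore] -/
def concatHtpy (F G : X × ℝ → Z) : X × ℝ → Z := fun p =>
  if p.2 ≤ 1 / 2 then F (p.1, 2 * p.2) else G (p.1, 2 * p.2 - 1)

/-- The concatenation starts where `F` starts. [folklore] -/
@[simp]
theorem concatHtpy_zero (F G : X × ℝ → Z) (x : X) : concatHtpy F G (x, 0) = F (x, 0) := by
  simp only [concatHtpy]
  norm_num

/-- The concatenation ends where `G` ends. [folklore] -/
@[simp]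
theorem concatHtpy_one (F G : X × ℝ → Z) (x : X) : concatHtpy F G (x, 1) = G (x, 1) := by
  simp only [concatHtpy]
  norm_num

/-- If both homotopies are stationary at `x` with value `v`, so is the concatenation.
[folklore] -/
theorem concatHtpy_eq_of_forall (F G : X × ℝ → Z) {x : X} {v : Z} (hF : ∀ t, F (x, t) = v)
    (hG : ∀ t, G (x, t) = v) (t : ℝ) : concatHtpy F G (x, t) = v := by
  unfold concatHtpy
  split_ifs
  · exact hF _
  · exact hG _

/-- Values of the concatenation on `[0, 1]` are values of `F` or of `G` on `[0, 1]`.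
[folklore] -/
theorem concatHtpy_mem (F G : X × ℝ → Z) {x : X} {A : Set Z} (hF : ∀ t ∈ Icc (0 : ℝ) 1, F (x, t) ∈ A)
    (hG : ∀ t ∈ Icc (0 : ℝ) 1, G (x, t) ∈ A) {t : ℝ} (ht : t ∈ Icc (0 : ℝ) 1) :
    concatHtpy F G (x, t) ∈ A := by
  unfold concatHtpy
  split_ifs with h
  · exact hF _ ⟨by linarith [ht.1], by linarith⟩
  · exact hG _ ⟨by linarith [not_le.1 h], by linarith [ht.2]⟩

/-- **Continuity of the concatenation** on `S × [0, 1]`, given continuity of the pieces there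
and matching ends. [folklore] -/
theorem continuousOn_concatHtpy [TopologicalSpace X] [TopologicalSpace Z] {S : Set X} {F G : X × ℝ → Z}
    (hF : ContinuousOn F (S ×ˢ Icc (0 : ℝ) 1))
    (hG : ContinuousOn G (S ×ˢ Icc (0 : ℝ) 1)) (hFG : ∀ x ∈ S, F (x, 1) = G (x, 0)) :
    ContinuousOn (concatHtpy F G) (S ×ˢ Icc (0 : ℝ) 1) := by
  refine Telescope.continuousOn_if_le continuous_snd (1 / 2) ?_ ?_ ?_
  · refine hF.comp (by fun_prop : Continuous fun p : X × ℝ => (p.1, 2 * p.2)).continuousOn ?_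
    rintro ⟨x, t⟩ ⟨⟨hx, ht⟩, hle⟩
    exact ⟨hx, ⟨by linarith [ht.1], by linarith [show t ≤ 1 / 2 from hle]⟩⟩
  · refine hG.comp (by fun_prop : Continuous fun p : X × ℝ => (p.1, 2 * p.2 - 1)).continuousOn ?_
    rintro ⟨x, t⟩ ⟨⟨hx, ht⟩, hle⟩
    exact ⟨hx, ⟨by linarith [show 1 / 2 ≤ t from hle], by linarith [ht.2]⟩⟩
  · rintro ⟨x, t⟩ ⟨hx, -⟩ (ht : t = 1 / 2)
    subst ht
    show F (x, 2 * (1 / 2)) = G (x, 2 * (1 / 2) - 1)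
    norm_num [hFG x hx]

end Concat

/-! ### Clearing cells -/

section Clear

variable {Y : Type*} [TopologicalSpace Y] [T2Space Y] [CWComplex (univ : Set Y)]

/-- **Clearing one cell** (Hatcher 2002, proof of Thm. 4.8): a map of the closed `n`-cube into
`skeletonLT (m+2)` (`n ≤ m`) is homotopic, by a homotopy stationary wherever the map misses the
open `(m+1)`-cell `e` and moving points only inside `ē`, to a map missing `e`.
[cite: HatcherAT2002, Thm. 4.8 (proof, p. 349)] -/
theorem exists_homotopy_clear_cell {n m : ℕ} (hnm : n ≤ m) (j : RelCWComplex.cell (univ : Set Y) (m + 1))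
    (c : (Fin n → ℝ) → Y) (hc : ContinuousOn c (closedBall 0 1))
    (hcY : MapsTo c (closedBall 0 1) (RelCWComplex.skeletonLT (univ : Set Y) (m + 1 + 1 : ℕ) : Set Y)) :
    ∃ Γ : (Fin n → ℝ) × ℝ → Y,
      ContinuousOn Γ (closedBall (0 : Fin n → ℝ) 1 ×ˢ Icc (0 : ℝ) 1) ∧
      (∀ w ∈ closedBall (0 : Fin n → ℝ) 1, Γ (w, 0) = c w) ∧
      (∀ w ∈ closedBall (0 : Fin n → ℝ) 1, c w ∉ RelCWComplex.openCell (m + 1) j → ∀ t, Γ (w, t) = c w) ∧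
      (∀ w ∈ closedBall (0 : Fin n → ℝ) 1, ∀ t ∈ Icc (0 : ℝ) 1,
        Γ (w, t) = c w ∨ Γ (w, t) ∈ RelCWComplex.closedCell (m + 1) j) ∧
      (∀ w ∈ closedBall (0 : Fin n → ℝ) 1, Γ (w, 1) ∉ RelCWComplex.openCell (m + 1) j) := by
  obtain ⟨K, p, hp, hKc, hK0, hKstat, hKval, hKmiss⟩ :=
    exists_homotopy_missing_point (k := n) (m := m + 1) (by omega) j c hc hcY
  set c₁ : (Fin n → ℝ) → Y := fun w => K (w, 1) with hc₁
  have hc₁c : ContinuousOn c₁ (closedBall 0 1) :=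
    hKc.comp (by fun_prop : Continuous fun w : Fin n → ℝ => (w, (1 : ℝ))).continuousOn
      fun w hw => ⟨hw, ⟨zero_le_one, le_rfl⟩⟩
  have hc₁Y : MapsTo c₁ (closedBall 0 1) (RelCWComplex.skeletonLT (univ : Set Y) (m + 1 + 1 : ℕ) : Set Y) := by
    intro w hw
    rcases hKval w hw 1 ⟨zero_le_one, le_rfl⟩ with h | h
    · show K (w, 1) ∈ _; rw [h]; exact hcY hw
    · exact RelCWComplex.openCell_subset_skeletonLT (m + 1) j h
  obtain ⟨q, hq, hpq⟩ := hp
  have hq1 : ‖q‖ < 1 := mem_ball_zero_iff.1 hq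
  have hmiss : ∀ w ∈ closedBall (0 : Fin n → ℝ) 1, c₁ w ≠ RelCWComplex.map (m + 1) j q := fun w hw => by
    rw [hpq]; exact hKmiss w hw
  obtain ⟨R, hRc, hR0, hRstat, hRval, hRend⟩ := exists_homotopy_off_cell j c₁ hc₁c hc₁Y hq1 hmiss
  refine ⟨concatHtpy K R, continuousOn_concatHtpy hKc hRc fun w hw => (hR0 w hw).symm, fun w hw => ?_,
    fun w hw hwe t => ?_, fun w hw t ht => ?_, fun w hw => ?_⟩
  · rw [concatHtpy_zero]; exact hK0 w hw
  · have h1 : ∀ t, K (w, t) = c w := fun t => hKstat w hw t hwe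
    refine concatHtpy_eq_of_forall K R h1 (fun t => ?_) t
    have h2 : c₁ w = c w := h1 1
    rw [hRstat w hw t (by rw [h2]; exact hwe), h2]
  · have hsub : RelCWComplex.openCell (m + 1) j ⊆ RelCWComplex.closedCell (C := (univ : Set Y)) (m + 1) j :=
      RelCWComplex.openCell_subset_closedCell (m + 1) j
    refine concatHtpy_mem K R (A := {y | y = c w ∨ y ∈ RelCWComplex.closedCell (m + 1) j}) (fun s hs => ?_)
      (fun s hs => ?_) ht
    · rcases hKval w hw s hs with h | h
      · exact Or.inl h
      · exact Or.inr (hsub h)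
    · rcases hRval w hw s hs with h | h
      · rw [mem_setOf_eq, h]
        rcases hKval w hw 1 ⟨zero_le_one, le_rfl⟩ with h' | h'
        · exact Or.inl h'
        · exact Or.inr (hsub h')
      · exact Or.inr h
  · rw [concatHtpy_one]; exact hRend w hw

/-- Points of `skeletonLT (m+2)` outside all open `(m+1)`-cells lie in `skeletonLT (m+1)`.
[folklore] -/
theorem mem_skeletonLT_of_forall_not_mem_openCell {m : ℕ} {y : Y}
    (hy : y ∈ (RelCWComplex.skeletonLT (univ : Set Y) (m + 1 + 1 : ℕ) : Set Y))
    (h : ∀ j : RelCWComplex.cell (univ : Set Y) (m + 1), y ∉ RelCWComplex.openCell (m + 1) j) :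
    y ∈ (RelCWComplex.skeletonLT (univ : Set Y) (m + 1 : ℕ) : Set Y) := by
  obtain ⟨m', hm', j, hyj⟩ := CWComplex.mem_skeletonLT_iff.1 (SetLike.mem_coe.1 hy)
  have hm'' : m' < m + 1 + 1 := by exact_mod_cast hm'
  rcases Nat.lt_succ_iff_lt_or_eq.1 hm'' with hlt | heq
  · exact SetLike.mem_coe.2 (CWComplex.mem_skeletonLT_iff.2 ⟨m', by exact_mod_cast hlt, j, hyj⟩)
  · subst heq; exact absurd hyj (h j)

/-- Clearing the open `(m+1)`-cells of a finite set `T` containing all those met.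
[cite: HatcherAT2002, Thm. 4.8 (proof, p. 349)] -/
theorem exists_homotopy_clear_finset {n m : ℕ} (hnm : n ≤ m) (T : Finset (RelCWComplex.cell (univ : Set Y) (m + 1))) :
    ∀ c : (Fin n → ℝ) → Y, ContinuousOn c (closedBall 0 1) →
      MapsTo c (closedBall 0 1) (RelCWComplex.skeletonLT (univ : Set Y) (m + 1 + 1 : ℕ) : Set Y) →
      (∀ w ∈ closedBall (0 : Fin n → ℝ) 1, ∀ j, c w ∈ RelCWComplex.openCell (m + 1) j → j ∈ T) →
      ∃ Γ : (Fin n → ℝ) × ℝ → Y,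
        ContinuousOn Γ (closedBall (0 : Fin n → ℝ) 1 ×ˢ Icc (0 : ℝ) 1) ∧
        (∀ w ∈ closedBall (0 : Fin n → ℝ) 1, Γ (w, 0) = c w) ∧
        (∀ w ∈ closedBall (0 : Fin n → ℝ) 1,
          c w ∈ (RelCWComplex.skeletonLT (univ : Set Y) (m + 1 : ℕ) : Set Y) → ∀ t, Γ (w, t) = c w) ∧
        (∀ w ∈ closedBall (0 : Fin n → ℝ) 1, ∀ t ∈ Icc (0 : ℝ) 1,
          Γ (w, t) ∈ (RelCWComplex.skeletonLT (univ : Set Y) (m + 1 + 1 : ℕ) : Set Y)) ∧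
        (∀ w ∈ closedBall (0 : Fin n → ℝ) 1,
          Γ (w, 1) ∈ (RelCWComplex.skeletonLT (univ : Set Y) (m + 1 : ℕ) : Set Y)) := by
  classical
  induction T using Finset.induction_on with
  | empty =>
    intro c hc hcY hT
    have hcS : ∀ w ∈ closedBall (0 : Fin n → ℝ) 1,
        c w ∈ (RelCWComplex.skeletonLT (univ : Set Y) (m + 1 : ℕ) : Set Y) := fun w hw =>
      mem_skeletonLT_of_forall_not_mem_openCell (hcY hw) fun j hj => by simpa using hT w hw j hj
    refine ⟨fun p => c p.1, hc.comp continuousOn_fst fun p hp => hp.1, fun w _ => rfl, fun w _ _ t => rfl,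
      fun w hw t _ => hcY hw, fun w hw => hcS w hw⟩
  | insert a T haT ih =>
    intro c hc hcY hT
    obtain ⟨Γ₁, hΓ₁c, hΓ₁0, hΓ₁stat, hΓ₁val, hΓ₁end⟩ := exists_homotopy_clear_cell hnm a c hc hcY
    set c' : (Fin n → ℝ) → Y := fun w => Γ₁ (w, 1) with hc'
    have hc'c : ContinuousOn c' (closedBall 0 1) :=
      hΓ₁c.comp (by fun_prop : Continuous fun w : Fin n → ℝ => (w, (1 : ℝ))).continuousOn
        fun w hw => ⟨hw, ⟨zero_le_one, le_rfl⟩⟩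
    have hsk : RelCWComplex.closedCell (m + 1) a ⊆ (RelCWComplex.skeletonLT (univ : Set Y) (m + 1 + 1 : ℕ) : Set Y) :=
      RelCWComplex.closedCell_subset_skeletonLT (m + 1) a
    have hc'Y : MapsTo c' (closedBall 0 1) (RelCWComplex.skeletonLT (univ : Set Y) (m + 1 + 1 : ℕ) : Set Y) := by
      intro w hw
      rcases hΓ₁val w hw 1 ⟨zero_le_one, le_rfl⟩ with h | h
      · show Γ₁ (w, 1) ∈ _; rw [h]; exact hcY hw
      · exact hsk h
    have hT' : ∀ w ∈ closedBall (0 : Fin n → ℝ) 1, ∀ j, c' w ∈ RelCWComplex.openCell (m + 1) j → j ∈ T := by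
      intro w hw j hj
      have hja : j ≠ a := by
        rintro rfl; exact hΓ₁end w hw hj
      rcases hΓ₁val w hw 1 ⟨zero_le_one, le_rfl⟩ with h | h
      · have := hT w hw j (by rw [← h]; exact hj)
        rcases Finset.mem_insert.1 this with h' | h'
        · exact absurd h' hja
        · exact h'
      · -- `c' w ∈ ē_a ∩ e_j = ∅`
        exfalso
        rw [← RelCWComplex.cellFrontier_union_openCell_eq_closedCell] at h
        rcases h with h | h
        · exact Set.disjoint_left.1 (RelCWComplex.disjoint_skeletonLT_openCell (C := (univ : Set Y))
            (n := ((m + 1 : ℕ) : ℕ∞)) (m := m + 1) (j := j) le_rfl)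
            (RelCWComplex.cellFrontier_subset_skeletonLT (m + 1) a h) hj
        · have hne : (⟨m + 1, a⟩ : Σ k, RelCWComplex.cell (univ : Set Y) k) ≠ ⟨m + 1, j⟩ := by
            intro h'
            apply hja
            have := (Sigma.mk.inj_iff.1 h').2
            exact (eq_of_heq this).symm
          exact Set.disjoint_left.1 (RelCWComplex.disjoint_openCell_of_ne hne) h hj
    obtain ⟨Γ₂, hΓ₂c, hΓ₂0, hΓ₂stat, hΓ₂val, hΓ₂end⟩ := ih c' hc'c hc'Y hT'
    refine ⟨concatHtpy Γ₁ Γ₂, continuousOn_concatHtpy hΓ₁c hΓ₂c fun w hw => (hΓ₂0 w hw).symm,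
      fun w hw => ?_, fun w hw hws t => ?_, fun w hw t ht => ?_, fun w hw => ?_⟩
    · rw [concatHtpy_zero]; exact hΓ₁0 w hw
    · have hwe : c w ∉ RelCWComplex.openCell (m + 1) a := fun h =>
        Set.disjoint_left.1 (RelCWComplex.disjoint_skeletonLT_openCell (C := (univ : Set Y))
          (n := ((m + 1 : ℕ) : ℕ∞)) (m := m + 1) (j := a) le_rfl) hws h
      have h1 : ∀ t, Γ₁ (w, t) = c w := hΓ₁stat w hw hwe
      have h2 : c' w = c w := h1 1
      exact concatHtpy_eq_of_forall Γ₁ Γ₂ h1 (fun t => by rw [hΓ₂stat w hw (by rw [h2]; exact hws), h2]) t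
    · refine concatHtpy_mem Γ₁ Γ₂ (fun s hs => ?_) (fun s hs => hΓ₂val w hw s hs) ht
      rcases hΓ₁val w hw s hs with h | h
      · rw [h]; exact hcY hw
      · exact hsk h
    · rw [concatHtpy_one]; exact hΓ₂end w hw

/-- **Clearing one dimension**: a map of the closed `n`-cube into `skeletonLT (m+2)` (`n ≤ m`)
is homotopic inside `skeletonLT (m+2)`, relative to the points mapped into `skeletonLT (m+1)`,
to a map into `skeletonLT (m+1)`. [cite: HatcherAT2002, Thm. 4.8 (proof, p. 349)] -/
theorem exists_homotopy_clear_dim {n m : ℕ} (hnm : n ≤ m) (c : (Fin n → ℝ) → Y) (hc : ContinuousOn c (closedBall 0 1))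
    (hcY : MapsTo c (closedBall 0 1) (RelCWComplex.skeletonLT (univ : Set Y) (m + 1 + 1 : ℕ) : Set Y)) :
    ∃ Γ : (Fin n → ℝ) × ℝ → Y,
      ContinuousOn Γ (closedBall (0 : Fin n → ℝ) 1 ×ˢ Icc (0 : ℝ) 1) ∧
      (∀ w ∈ closedBall (0 : Fin n → ℝ) 1, Γ (w, 0) = c w) ∧
      (∀ w ∈ closedBall (0 : Fin n → ℝ) 1,
        c w ∈ (RelCWComplex.skeletonLT (univ : Set Y) (m + 1 : ℕ) : Set Y) → ∀ t, Γ (w, t) = c w) ∧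
      (∀ w ∈ closedBall (0 : Fin n → ℝ) 1, ∀ t ∈ Icc (0 : ℝ) 1,
        Γ (w, t) ∈ (RelCWComplex.skeletonLT (univ : Set Y) (m + 1 + 1 : ℕ) : Set Y)) ∧
      (∀ w ∈ closedBall (0 : Fin n → ℝ) 1,
        Γ (w, 1) ∈ (RelCWComplex.skeletonLT (univ : Set Y) (m + 1 : ℕ) : Set Y)) := by
  classical
  -- the finitely many `(m+1)`-cells met by the compact image
  have hK : IsCompact (c '' closedBall (0 : Fin n → ℝ) 1) := (isCompact_closedBall _ _).image_of_continuousOn hc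
  have hfin := finite_cells_inter_of_isCompact hK
  have hfinT : ((fun j : RelCWComplex.cell (univ : Set Y) (m + 1) =>
      (⟨m + 1, j⟩ : Σ k, RelCWComplex.cell (univ : Set Y) k)) ⁻¹'
      {p : Σ k, RelCWComplex.cell (univ : Set Y) k |
        (RelCWComplex.openCell p.1 p.2 ∩ c '' closedBall (0 : Fin n → ℝ) 1).Nonempty}).Finite :=
    hfin.preimage sigma_mk_injective.injOn
  refine exists_homotopy_clear_finset hnm hfinT.toFinset c hc hcY fun w hw j hj => ?_
  rw [Set.Finite.mem_toFinset]
  exact ⟨c w, hj, w, hw, rfl⟩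

/-- Downward induction over the dimensions `n + d, …, n + 1`. [cite: HatcherAT2002, Thm. 4.8 (proof, p. 349)] -/
theorem exists_homotopy_into_skeleton_of_mapsTo (n d : ℕ) :
    ∀ c : (Fin n → ℝ) → Y, ContinuousOn c (closedBall 0 1) →
      MapsTo c (closedBall 0 1) (RelCWComplex.skeletonLT (univ : Set Y) (n + d + 1 : ℕ) : Set Y) →
      ∃ Γ : (Fin n → ℝ) × ℝ → Y,
        ContinuousOn Γ (closedBall (0 : Fin n → ℝ) 1 ×ˢ Icc (0 : ℝ) 1) ∧
        (∀ w ∈ closedBall (0 : Fin n → ℝ) 1, Γ (w, 0) = c w) ∧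
        (∀ w ∈ closedBall (0 : Fin n → ℝ) 1,
          c w ∈ (RelCWComplex.skeletonLT (univ : Set Y) (n + 1 : ℕ) : Set Y) → ∀ t, Γ (w, t) = c w) ∧
        (∀ w ∈ closedBall (0 : Fin n → ℝ) 1,
          Γ (w, 1) ∈ (RelCWComplex.skeletonLT (univ : Set Y) (n + 1 : ℕ) : Set Y)) := by
  induction d with
  | zero =>
    intro c hc hcY
    exact ⟨fun p => c p.1, hc.comp continuousOn_fst fun p hp => hp.1, fun w _ => rfl, fun w _ _ t => rfl,
      fun w hw => by simpa using hcY hw⟩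
  | succ d ih =>
    intro c hc hcY
    have heq : n + (d + 1) + 1 = n + d + 1 + 1 := by omega
    rw [heq] at hcY
    obtain ⟨Γ₁, hΓ₁c, hΓ₁0, hΓ₁stat, -, hΓ₁end⟩ := exists_homotopy_clear_dim (Nat.le_add_right n d) c hc hcY
    set c' : (Fin n → ℝ) → Y := fun w => Γ₁ (w, 1) with hc'
    have hc'c : ContinuousOn c' (closedBall 0 1) :=
      hΓ₁c.comp (by fun_prop : Continuous fun w : Fin n → ℝ => (w, (1 : ℝ))).continuousOn
        fun w hw => ⟨hw, ⟨zero_le_one, le_rfl⟩⟩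
    obtain ⟨Γ₂, hΓ₂c, hΓ₂0, hΓ₂stat, hΓ₂end⟩ := ih c' hc'c fun w hw => hΓ₁end w hw
    have hmono : (RelCWComplex.skeletonLT (univ : Set Y) (n + 1 : ℕ) : Set Y) ⊆
        (RelCWComplex.skeletonLT (univ : Set Y) (n + d + 1 : ℕ) : Set Y) :=
      RelCWComplex.skeletonLT_mono (by exact_mod_cast (by omega : n + 1 ≤ n + d + 1))
    refine ⟨concatHtpy Γ₁ Γ₂, continuousOn_concatHtpy hΓ₁c hΓ₂c fun w hw => (hΓ₂0 w hw).symm,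
      fun w hw => ?_, fun w hw hws t => ?_, fun w hw => ?_⟩
    · rw [concatHtpy_zero]; exact hΓ₁0 w hw
    · have h1 : ∀ t, Γ₁ (w, t) = c w := hΓ₁stat w hw (hmono hws)
      have h2 : c' w = c w := h1 1
      exact concatHtpy_eq_of_forall Γ₁ Γ₂ h1 (fun t => by rw [hΓ₂stat w hw (by rw [h2]; exact hws), h2]) t
    · rw [concatHtpy_one]; exact hΓ₂end w hw

/-- A compact subset of a CW complex lies in a finite skeleton. [cite: HatcherAT2002, Prop. A.1 (p. 520)] -/
theorem exists_subset_skeletonLT_of_isCompact {K : Set Y} (hK : IsCompact K) :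
    ∃ D : ℕ, K ⊆ (RelCWComplex.skeletonLT (univ : Set Y) (D : ℕ) : Set Y) := by
  classical
  have hfin := finite_cells_inter_of_isCompact hK
  refine ⟨hfin.toFinset.sup (fun p => p.1) + 1, fun y hy => ?_⟩
  have hy' : y ∈ ⋃ (n : ℕ) (j : RelCWComplex.cell (univ : Set Y) n), RelCWComplex.openCell n j := by
    rw [CWComplex.iUnion_openCell_eq_complex]; exact mem_univ y
  obtain ⟨k, j, hyj⟩ : ∃ k j, y ∈ RelCWComplex.openCell (C := (univ : Set Y)) k j := by
    simpa only [mem_iUnion] using hy'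
  have hmem : (⟨k, j⟩ : Σ k, RelCWComplex.cell (univ : Set Y) k) ∈ hfin.toFinset :=
    (Set.Finite.mem_toFinset _).2 ⟨y, hyj, hy⟩
  have hle : k ≤ hfin.toFinset.sup (fun p => p.1) := Finset.le_sup (f := fun p => p.1) hmem
  refine SetLike.mem_coe.2 (CWComplex.mem_skeletonLT_iff.2 ⟨k, ?_, j, hyj⟩)
  exact_mod_cast Nat.lt_succ_of_le hle

/-- **Pushing a cube into the skeleton** (the induction step of the cellular approximation
theorem, Hatcher 2002, Thm. 4.8, p. 349): a map `c` of the closed unit `n`-cube into a CW complex,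
continuous on the cube, is homotopic by a jointly continuous homotopy on `closedBall 0 1 × [0, 1]`,
stationary at every point already mapped into the `n`-skeleton `skeletonLT (n+1)`, to a map into
`skeletonLT (n+1)`. [cite: HatcherAT2002, Thm. 4.8 (proof, p. 349)] -/
theorem exists_homotopy_into_skeleton (n : ℕ) (c : (Fin n → ℝ) → Y) (hc : ContinuousOn c (closedBall 0 1)) :
    ∃ Γ : (Fin n → ℝ) × ℝ → Y,
      ContinuousOn Γ (closedBall (0 : Fin n → ℝ) 1 ×ˢ Icc (0 : ℝ) 1) ∧
      (∀ w ∈ closedBall (0 : Fin n → ℝ) 1, Γ (w, 0) = c w) ∧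
      (∀ w ∈ closedBall (0 : Fin n → ℝ) 1,
        c w ∈ (RelCWComplex.skeletonLT (univ : Set Y) (n + 1 : ℕ) : Set Y) → ∀ t, Γ (w, t) = c w) ∧
      (∀ w ∈ closedBall (0 : Fin n → ℝ) 1,
        Γ (w, 1) ∈ (RelCWComplex.skeletonLT (univ : Set Y) (n + 1 : ℕ) : Set Y)) := by
  obtain ⟨D, hD⟩ := exists_subset_skeletonLT_of_isCompact ((isCompact_closedBall _ _).image_of_continuousOn hc)
  refine exists_homotopy_into_skeleton_of_mapsTo n D c hc fun w hw => ?_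
  have hmono : (RelCWComplex.skeletonLT (univ : Set Y) (D : ℕ) : Set Y) ⊆
      (RelCWComplex.skeletonLT (univ : Set Y) (n + D + 1 : ℕ) : Set Y) :=
    RelCWComplex.skeletonLT_mono (by exact_mod_cast (by omega : D ≤ n + D + 1))
  exact hmono (hD ⟨w, hw, rfl⟩)

end Clear

end Literature.AlgebraicTopology.Homotopy

end
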